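import Literature.LinearAlgebra.Alternating.GradedForms
import HarnessLib

/-!
# Pointwise Hodge–Riemann, I: unitary frames acting on graded forms — supports and weights

Topic `Literature/Geometry/Kaehler`. First file of the pointwise Hodge–Riemann bilinear relation
(D. Huybrechts, *Complex Geometry* (2005), Cor. 1.2.36; C. Voisin, *Hodge Theory and Complex
Algebraic Geometry I* (2002), §6.3.2 Thm. 6.32 at a point), in the graded-form calculus of
`Literature/LinearAlgebra/Alternating/GradedForms.lean`. Setting (as in `LefschetzPointwise.lean`):
a finite-dimensional real inner product space `V` with an isometric complex structure `J`
(`J² = -1`, `⟪Jv, Jw⟫ = ⟪v, w⟫`) and a unitary frame `u : Fin d → V` (`exists_unitaryFrame`: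
`(uₐ, Juₐ)ₐ` is an orthonormal basis, `dim V = 2d`), with its dual coframe
`θₐ = ⟪uₐ, ·⟫`, `θ'ₐ = ⟪Juₐ, ·⟫`. We record:

* the frame identities and the partial projections `frameProj S v = ∑_{a ∈ S} (⟪uₐ,v⟫ uₐ + ⟪Juₐ,v⟫ Juₐ)`;
* **supports**: a graded form is *supported in `S ⊆ Fin d`* (`IsFrameSupported`) if it is killed
  by the interior products `uₐ ⌟`, `Juₐ ⌟` for `a ∉ S`; equivalently (`isFrameSupported_iff_pullG`)
  it is invariant under pull-back by `frameProj S`; closure under the operations of the calculus,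
  and **vanishing above the top degree** `2|S|` (`IsFrameSupported.apply_eq_zero_of_lt`);
* the **rotations** `R_t = cos t + sin t · J` and **weights**: `HasRotWeight n w` iff
  `R_t^* w = e^{int} w` for all `t` (a complex `k`-form has type `(p,q)` iff it has weight `p - q`,
  Voisin §2.3.1 — the pointwise content of the tree's `IsOfType`); the action of `R_t` on the
  coframe, and the weights of wedges and interior products against the frame (co)vectors.

Everything is proved; no named fact is introduced.

## References

* C. Voisin, *Hodge Theory and Complex Algebraic Geometry I*, CUP (2002), §2.3.1, §3.1.1, §6.3.2.
  [Voisin2002]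
* D. Huybrechts, *Complex Geometry. An Introduction* (2005), §1.2 (Lemma 1.2.17, Cor. 1.2.36).
  [Huybrechts2005]
-/

noncomputable section

open Module Submodule ContinuousAlternatingMap Function Finset
open scoped InnerProductSpace
open Literature.LinearAlgebra.Alternating Literature.LinearAlgebra.Alternating.GForm

namespace Literature.Geometry.Kaehler

section Frame

variable {V : Type*} [NormedAddCommGroup V] [InnerProductSpace ℝ V]
  (J : V →L[ℝ] V) (hJJ : ∀ v, J (J v) = -v) (hJ : ∀ v w, ⟪J v, J w⟫_ℝ = ⟪v, w⟫_ℝ)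
  {d : ℕ} (u : Fin d → V) (hu : Orthonormal ℝ u) (huJ : ∀ i j, ⟪u i, J (u j)⟫_ℝ = 0)
  {F : Type*} [NormedAddCommGroup F] [NormedSpace ℝ F]

/-! ### The frame identities -/

include hu in
/-- `θₐ(u_b) = δ_{ab}`. [folklore] -/
theorem frame_inner_u_u (a b : Fin d) : ⟪u a, u b⟫_ℝ = if a = b then 1 else 0 :=
  orthonormal_iff_ite.1 hu a b

include hJ hu in
/-- `θ'ₐ(Ju_b) = δ_{ab}`. [folklore] -/
theorem frame_inner_Ju_Ju (a b : Fin d) : ⟪J (u a), J (u b)⟫_ℝ = if a = b then 1 else 0 := by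
  rw [hJ]; exact orthonormal_iff_ite.1 hu a b

include hJJ hJ huJ in
/-- `θ'ₐ(u_b) = 0`. [folklore] -/
theorem frame_inner_Ju_u (a b : Fin d) : ⟪J (u a), u b⟫_ℝ = 0 := by
  rw [inner_J_left_eq_neg J hJJ hJ, huJ, neg_zero]

/-! ### Partial projections on the frame -/

/-- **The partial frame projection** `frameProj S v = ∑_{a ∈ S} (⟪uₐ, v⟫ uₐ + ⟪Juₐ, v⟫ Juₐ)`, the
orthogonal projection onto `span {uₐ, Juₐ : a ∈ S}`. [cite: Voisin2002, §3.1.1] -/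
def frameProj (S : Finset (Fin d)) : V →L[ℝ] V :=
  ∑ a ∈ S, ((innerSL ℝ (u a)).smulRight (u a) + (innerSL ℝ (J (u a))).smulRight (J (u a)))

/-- Unfolding of `frameProj`. [folklore] -/
theorem frameProj_apply (S : Finset (Fin d)) (v : V) :
    frameProj J u S v = ∑ a ∈ S, (⟪u a, v⟫_ℝ • u a + ⟪J (u a), v⟫_ℝ • J (u a)) := by
  simp [frameProj, innerSL_apply_apply]

include hJJ hJ hu huJ in
/-- **Completeness of the frame**: `frameProj univ = id`, `dim V = 2d`. [cite: Voisin2002, §3.1.1] -/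
theorem frameProj_univ [FiniteDimensional ℝ V] (hd : finrank ℝ V = 2 * d) (v : V) :
    frameProj J u univ v = v := by
  rw [frameProj_apply]
  exact sum_inner_unitaryFrame_smul J hJJ hJ u hd hu huJ v

include hJJ hJ hu huJ in
/-- A vector is its `S`-projection plus a combination of the frame vectors outside `S`. [folklore] -/
theorem eq_frameProj_add_sum_compl [FiniteDimensional ℝ V] (hd : finrank ℝ V = 2 * d)
    (S : Finset (Fin d)) (v : V) :
    v = frameProj J u S v + ∑ a ∈ Sᶜ, (⟪u a, v⟫_ℝ • u a + ⟪J (u a), v⟫_ℝ • J (u a)) := by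
  rw [frameProj_apply, Finset.sum_add_sum_compl, ← frameProj_apply, frameProj_univ J hJJ hJ u hu huJ hd]

include hJJ hJ hu huJ in
/-- `frameProj S uₐ = uₐ` for `a ∈ S`, `= 0` for `a ∉ S`. [folklore] -/
theorem frameProj_u (S : Finset (Fin d)) (a : Fin d) :
    frameProj J u S (u a) = if a ∈ S then u a else 0 := by
  rw [frameProj_apply]
  have : ∀ b ∈ S, (⟪u b, u a⟫_ℝ • u b + ⟪J (u b), u a⟫_ℝ • J (u b)) = if a = b then u a else 0 := by
    intro b _
    rw [frame_inner_u_u u hu, frame_inner_Ju_u J hJJ hJ u huJ, zero_smul, add_zero]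
    by_cases h : a = b
    · subst h; rw [if_pos rfl, if_pos rfl, one_smul]
    · rw [if_neg (Ne.symm h), if_neg h, zero_smul]
  rw [Finset.sum_congr rfl this, Finset.sum_ite_eq]

include hJ hu huJ in
/-- `frameProj S (Juₐ) = Juₐ` for `a ∈ S`, `= 0` for `a ∉ S`. [folklore] -/
theorem frameProj_Ju (S : Finset (Fin d)) (a : Fin d) :
    frameProj J u S (J (u a)) = if a ∈ S then J (u a) else 0 := by
  rw [frameProj_apply]
  have : ∀ b ∈ S, (⟪u b, J (u a)⟫_ℝ • u b + ⟪J (u b), J (u a)⟫_ℝ • J (u b)) =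
      if a = b then J (u a) else 0 := by
    intro b _
    rw [huJ, frame_inner_Ju_Ju J hJ u hu, zero_smul, zero_add]
    by_cases h : a = b
    · subst h; rw [if_pos rfl, if_pos rfl, one_smul]
    · rw [if_neg (Ne.symm h), if_neg h, zero_smul]
  rw [Finset.sum_congr rfl this, Finset.sum_ite_eq]

include hu huJ in
/-- `θₐ ∘ frameProj S = θₐ` for `a ∈ S`, `= 0` for `a ∉ S`. [folklore] -/
theorem innerSL_u_comp_frameProj (S : Finset (Fin d)) (a : Fin d) :
    (innerSL ℝ (u a)).comp (frameProj J u S) = if a ∈ S then innerSL ℝ (u a) else 0 := by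
  ext v
  rw [ContinuousLinearMap.comp_apply, innerSL_apply_apply, frameProj_apply, inner_sum]
  have : ∀ b ∈ S, ⟪u a, ⟪u b, v⟫_ℝ • u b + ⟪J (u b), v⟫_ℝ • J (u b)⟫_ℝ =
      if a = b then ⟪u a, v⟫_ℝ else 0 := by
    intro b _
    rw [inner_add_right, inner_smul_right, inner_smul_right, frame_inner_u_u u hu, huJ, mul_zero,
      add_zero]
    by_cases h : a = b
    · subst h; rw [if_pos rfl, if_pos rfl, mul_one]
    · rw [if_neg h, if_neg h, mul_zero]
  rw [Finset.sum_congr rfl this, Finset.sum_ite_eq]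
  by_cases ha : a ∈ S
  · rw [if_pos ha, if_pos ha, innerSL_apply_apply]
  · rw [if_neg ha, if_neg ha]; rfl

include hJJ hJ hu huJ in
/-- `θ'ₐ ∘ frameProj S = θ'ₐ` for `a ∈ S`, `= 0` for `a ∉ S`. [folklore] -/
theorem innerSL_Ju_comp_frameProj (S : Finset (Fin d)) (a : Fin d) :
    (innerSL ℝ (J (u a))).comp (frameProj J u S) = if a ∈ S then innerSL ℝ (J (u a)) else 0 := by
  ext v
  rw [ContinuousLinearMap.comp_apply, innerSL_apply_apply, frameProj_apply, inner_sum]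
  have : ∀ b ∈ S, ⟪J (u a), ⟪u b, v⟫_ℝ • u b + ⟪J (u b), v⟫_ℝ • J (u b)⟫_ℝ =
      if a = b then ⟪J (u a), v⟫_ℝ else 0 := by
    intro b _
    rw [inner_add_right, inner_smul_right, inner_smul_right, frame_inner_Ju_u J hJJ hJ u huJ,
      frame_inner_Ju_Ju J hJ u hu, mul_zero, zero_add]
    by_cases h : a = b
    · subst h; rw [if_pos rfl, if_pos rfl, mul_one]
    · rw [if_neg h, if_neg h, mul_zero]
  rw [Finset.sum_congr rfl this, Finset.sum_ite_eq]
  by_cases ha : a ∈ S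
  · rw [if_pos ha, if_pos ha, innerSL_apply_apply]
  · rw [if_neg ha, if_neg ha]; rfl

/-- The family of the `2|S|` frame vectors indexed by `S`. [folklore] -/
def frameFamily (S : Finset (Fin d)) : ↥S ⊕ ↥S → V := Sum.elim (fun a ↦ u a) (fun a ↦ J (u a))

/-- The range of `frameProj S` lies in the span of the `2|S|` frame vectors indexed by `S`. [folklore] -/
theorem frameProj_mem_span (S : Finset (Fin d)) (v : V) :
    frameProj J u S v ∈ span ℝ (Set.range (frameFamily J u S)) := by
  rw [frameProj_apply]
  refine Submodule.sum_mem _ fun a ha ↦ Submodule.add_mem _ ?_ ?_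
  · exact Submodule.smul_mem _ _ (Submodule.subset_span ⟨Sum.inl ⟨a, ha⟩, rfl⟩)
  · exact Submodule.smul_mem _ _ (Submodule.subset_span ⟨Sum.inr ⟨a, ha⟩, rfl⟩)

/-- **More than `2|S|` vectors in the range of `frameProj S` are linearly dependent.** [folklore] -/
theorem not_linearIndependent_frameProj (S : Finset (Fin d)) {m : ℕ} (hm : 2 * S.card < m)
    (v : Fin m → V) : ¬ LinearIndependent ℝ (fun i ↦ frameProj J u S (v i)) := by
  intro hli
  set W : Submodule ℝ V := span ℝ (Set.range (frameFamily J u S)) with hW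
  haveI : Module.Finite ℝ W := FiniteDimensional.span_of_finite ℝ (Set.finite_range _)
  let f : Fin m → W := fun i ↦ ⟨frameProj J u S (v i), frameProj_mem_span J u S (v i)⟩
  have hf : LinearIndependent ℝ f := LinearIndependent.of_comp W.subtype (by exact hli)
  have h1 := hf.fintype_card_le_finrank
  have h2 : finrank ℝ W ≤ Fintype.card (↥S ⊕ ↥S) := finrank_range_le_card _
  rw [Fintype.card_fin] at h1
  rw [Fintype.card_sum, Fintype.card_coe] at h2
  omega

/-! ### Forms killed by interior products: slots -/

/-- If all interior products of `η` by the vectors of a submodule vanish, then `η` vanishes on every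
tuple having an entry in that submodule. [folklore] -/
theorem apply_eq_zero_of_curryLeft_eq_zero {m : ℕ} (η : V [⋀^Fin (m + 1)]→L[ℝ] F) (Z : Submodule ℝ V)
    (hZ : ∀ z ∈ Z, η.curryLeft z = 0) (v : Fin (m + 1) → V) {i : Fin (m + 1)} (hi : v i ∈ Z) :
    η v = 0 := by
  classical
  -- move the slot `i` to the front
  have key : ∀ (t : Fin (m + 1) → V), t 0 ∈ Z → η t = 0 := by
    intro t ht
    have h := hZ (t 0) ht
    have : η t = (η.curryLeft (t 0)) (Fin.tail t) := by
      rw [curryLeft_apply_apply]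
      congr 1
      exact (Fin.cons_self_tail t).symm
    rw [this, h]; rfl
  rcases eq_or_ne i 0 with rfl | hi0
  · exact key v hi
  · have hsw := η.toAlternatingMap.map_swap v hi0.symm
    rw [ContinuousAlternatingMap.coe_toAlternatingMap] at hsw
    have h0 : (v ∘ Equiv.swap 0 i) 0 ∈ Z := by simpa using hi
    have := key _ h0
    rw [hsw, neg_eq_zero] at this
    exact this

/-! ### Supports -/

/-- A graded form is **supported in `S`** (for the frame `u`) if it is killed by the interior
products `uₐ ⌟` and `Juₐ ⌟` for every frame index `a ∉ S` (it "involves only the covectors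
`θₐ, θ'ₐ`, `a ∈ S`"). [folklore] -/
def IsFrameSupported (S : Finset (Fin d)) (w : GForm V F) : Prop :=
  ∀ a ∉ S, curryLeftG (u a) w = 0 ∧ curryLeftG (J (u a)) w = 0

namespace IsFrameSupported

variable {J u} {S T : Finset (Fin d)} {w w' : GForm V F}

/-- Every graded form is supported in the full frame. [folklore] -/
theorem univ (w : GForm V F) : IsFrameSupported J u Finset.univ w := fun a ha ↦ absurd (mem_univ a) ha

/-- Supports are monotone. [folklore] -/
theorem mono (h : IsFrameSupported J u S w) (hST : S ⊆ T) : IsFrameSupported J u T w :=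
  fun a ha ↦ h a fun h' ↦ ha (hST h')

/-- `0` is supported in every `S`. [folklore] -/
theorem zero : IsFrameSupported J u S (0 : GForm V F) := fun _ _ ↦
  ⟨LinearMap.map_zero _, LinearMap.map_zero _⟩

/-- Supports are stable under addition. [folklore] -/
theorem add (h : IsFrameSupported J u S w) (h' : IsFrameSupported J u S w') :
    IsFrameSupported J u S (w + w') := fun a ha ↦
  ⟨by rw [map_add, (h a ha).1, (h' a ha).1, add_zero], by rw [map_add, (h a ha).2, (h' a ha).2, add_zero]⟩

/-- Supports are stable under real scalars. [folklore] -/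
theorem smul (h : IsFrameSupported J u S w) (c : ℝ) : IsFrameSupported J u S (c • w) := fun a ha ↦
  ⟨by rw [map_smul, (h a ha).1, smul_zero], by rw [map_smul, (h a ha).2, smul_zero]⟩

/-- Supports are stable under negation. [folklore] -/
theorem neg (h : IsFrameSupported J u S w) : IsFrameSupported J u S (-w) := fun a ha ↦
  ⟨by rw [map_neg, (h a ha).1, neg_zero], by rw [map_neg, (h a ha).2, neg_zero]⟩

/-- Supports are stable under subtraction. [folklore] -/
theorem sub (h : IsFrameSupported J u S w) (h' : IsFrameSupported J u S w') :
    IsFrameSupported J u S (w - w') := by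
  rw [sub_eq_add_neg]; exact h.add h'.neg

/-- Supports are stable under finite sums. [folklore] -/
theorem sum {ι : Type*} (s : Finset ι) {w : ι → GForm V F} (h : ∀ i ∈ s, IsFrameSupported J u S (w i)) :
    IsFrameSupported J u S (∑ i ∈ s, w i) := by
  classical
  induction s using Finset.induction_on with
  | empty => rw [sum_empty]; exact zero
  | insert a s ha ih =>
    rw [sum_insert ha]
    exact (h a (mem_insert_self a s)).add (ih fun i hi ↦ h i (mem_insert_of_mem hi))

/-- Supports are stable under every interior product. [folklore] -/
theorem curryLeftG (h : IsFrameSupported J u S w) (x : V) : IsFrameSupported J u S (curryLeftG x w) :=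
  fun a ha ↦ ⟨by rw [curryLeftG_curryLeftG, (h a ha).1, LinearMap.map_zero, neg_zero],
    by rw [curryLeftG_curryLeftG, (h a ha).2, LinearMap.map_zero, neg_zero]⟩

/-- Supports are stable under the wedge by a covector vanishing on the frame vectors outside `S`.
[folklore] -/
theorem wedgeOneG_of_apply_eq_zero (h : IsFrameSupported J u S w) {ξ : V →L[ℝ] ℝ}
    (hξ : ∀ a ∉ S, ξ (u a) = 0 ∧ ξ (J (u a)) = 0) : IsFrameSupported J u S (wedgeOneG ξ w) :=
  fun a ha ↦ ⟨by rw [curryLeftG_wedgeOneG, (hξ a ha).1, zero_smul, (h a ha).1, LinearMap.map_zero, sub_zero],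
    by rw [curryLeftG_wedgeOneG, (hξ a ha).2, zero_smul, (h a ha).2, LinearMap.map_zero, sub_zero]⟩

/-- Supports are stable under `θ_b ∧ ·` for `b ∈ S`. [folklore] -/
theorem wedgeOneG_coframe (hu : Orthonormal ℝ u) (huJ : ∀ i j, ⟪u i, J (u j)⟫_ℝ = 0)
    (h : IsFrameSupported J u S w) {b : Fin d} (hb : b ∈ S) :
    IsFrameSupported J u S (wedgeOneG (innerSL ℝ (u b)) w) := by
  refine h.wedgeOneG_of_apply_eq_zero fun a ha ↦ ⟨?_, ?_⟩
  · rw [innerSL_apply_apply, frame_inner_u_u u hu, if_neg (fun h : b = a ↦ ha (h ▸ hb))]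
  · rw [innerSL_apply_apply, huJ]

/-- Supports are stable under `θ'_b ∧ ·` for `b ∈ S`. [folklore] -/
theorem wedgeOneG_coframe' (hJJ : ∀ v, J (J v) = -v) (hJ : ∀ v w, ⟪J v, J w⟫_ℝ = ⟪v, w⟫_ℝ)
    (hu : Orthonormal ℝ u) (huJ : ∀ i j, ⟪u i, J (u j)⟫_ℝ = 0)
    (h : IsFrameSupported J u S w) {b : Fin d} (hb : b ∈ S) :
    IsFrameSupported J u S (wedgeOneG (innerSL ℝ (J (u b))) w) := by
  refine h.wedgeOneG_of_apply_eq_zero fun a ha ↦ ⟨?_, ?_⟩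
  · rw [innerSL_apply_apply, frame_inner_Ju_u J hJJ hJ u huJ]
  · rw [innerSL_apply_apply, frame_inner_Ju_Ju J hJ u hu, if_neg (fun h : b = a ↦ ha (h ▸ hb))]

/-- Supports are stable under the Lefschetz-type operators `L_T` of the coframe for `T ⊆ S`.
[folklore] -/
theorem lefG_coframe (hJJ : ∀ v, J (J v) = -v) (hJ : ∀ v w, ⟪J v, J w⟫_ℝ = ⟪v, w⟫_ℝ)
    (hu : Orthonormal ℝ u) (huJ : ∀ i j, ⟪u i, J (u j)⟫_ℝ = 0)
    (h : IsFrameSupported J u S w) (hTS : T ⊆ S) :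
    IsFrameSupported J u S
      (GForm.lefG (fun a ↦ innerSL ℝ (u a)) (fun a ↦ innerSL ℝ (J (u a))) T w) := by
  rw [lefG_apply]
  exact sum T fun b hb ↦ (h.wedgeOneG_coframe' hJJ hJ hu huJ (hTS hb)).wedgeOneG_coframe hu huJ (hTS hb)

/-- Supports are stable under the powers of the Lefschetz-type operators. [folklore] -/
theorem lefG_pow_coframe (hJJ : ∀ v, J (J v) = -v) (hJ : ∀ v w, ⟪J v, J w⟫_ℝ = ⟪v, w⟫_ℝ)
    (hu : Orthonormal ℝ u) (huJ : ∀ i j, ⟪u i, J (u j)⟫_ℝ = 0)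
    (h : IsFrameSupported J u S w) (hTS : T ⊆ S) (r : ℕ) :
    IsFrameSupported J u S
      ((GForm.lefG (fun a ↦ innerSL ℝ (u a)) (fun a ↦ innerSL ℝ (J (u a))) T ^ r) w) := by
  induction r with
  | zero => exact h
  | succ r ih => rw [pow_succ', Module.End.mul_apply]; exact ih.lefG_coframe hJJ hJ hu huJ hTS

end IsFrameSupported

variable {J u} in
/-- Conjugation preserves supports. [folklore] -/
theorem IsFrameSupported.conjG {S : Finset (Fin d)} {w : GForm V ℂ} (h : IsFrameSupported J u S w) :
    IsFrameSupported J u S (conjG w) := fun a ha ↦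
  ⟨by rw [← conjG_curryLeftG, (h a ha).1, conjG_zero], by rw [← conjG_curryLeftG, (h a ha).2, conjG_zero]⟩

variable {J u} in
/-- Supports of `ℂ`-valued graded forms are stable under complex scalars. [folklore] -/
theorem IsFrameSupported.smul_complex {S : Finset (Fin d)} {w : GForm V ℂ} (h : IsFrameSupported J u S w)
    (c : ℂ) : IsFrameSupported J u S (c • w) := fun a ha ↦
  ⟨by rw [curryLeftG_smul_complex, (h a ha).1, smul_zero],
    by rw [curryLeftG_smul_complex, (h a ha).2, smul_zero]⟩

/-! ### Supports as invariance under the partial projection -/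

include hJJ hJ hu huJ in
/-- **A graded form supported in `S` is invariant under pull-back by the partial projection
`frameProj S`.** Componentwise: write each argument `vᵢ = P vᵢ + zᵢ` with `zᵢ` in the span of the
frame vectors outside `S`, expand multilinearly (`map_add_univ`); every term with some `zᵢ` dies,
the form being killed by the interior products of that span. [folklore] -/
theorem IsFrameSupported.pullG_frameProj [FiniteDimensional ℝ V] (hd : finrank ℝ V = 2 * d)
    {S : Finset (Fin d)} {w : GForm V F}
    (h : IsFrameSupported J u S w) : pullG (frameProj J u S) w = w := by
  classical
  funext m
  rw [pullG_apply]
  cases m with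
  | zero => ext v; simp [Subsingleton.elim (⇑(frameProj J u S) ∘ v) v]
  | succ m =>
    ext v
    rw [compContinuousLinearMap_apply]
    -- the submodule spanned by the frame vectors outside `S` kills `w (m+1)` by interior products
    set Z : Submodule ℝ V := span ℝ (Set.range (frameFamily J u Sᶜ)) with hZ
    have hZker : ∀ z ∈ Z, (w (m + 1)).curryLeft z = 0 := by
      intro z hz
      induction hz using Submodule.span_induction with
      | mem x hx =>
        obtain ⟨i, rfl⟩ := hx
        rcases i with a | a
        · have := congrFun (h a (Finset.mem_compl.1 a.2)).1 m
          rwa [curryLeftG_apply] at this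
        · have := congrFun (h a (Finset.mem_compl.1 a.2)).2 m
          rwa [curryLeftG_apply] at this
      | zero => exact (w (m + 1)).curryLeft.map_zero
      | add x y _ _ hx hy => rw [map_add, hx, hy, add_zero]
      | smul c x _ hx => rw [map_smul, hx, smul_zero]
    -- decomposition of each argument
    set Pv : Fin (m + 1) → V := fun i ↦ frameProj J u S (v i) with hPv
    set z : Fin (m + 1) → V := fun i ↦ ∑ a ∈ Sᶜ, (⟪u a, v i⟫_ℝ • u a + ⟪J (u a), v i⟫_ℝ • J (u a))
      with hz
    have hvz : v = Pv + z := by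
      funext i
      exact eq_frameProj_add_sum_compl J hJJ hJ u hu huJ hd S (v i)
    have hzZ : ∀ i, z i ∈ Z := by
      intro i
      refine Submodule.sum_mem _ fun a ha ↦ Submodule.add_mem _ ?_ ?_
      · exact Submodule.smul_mem _ _ (Submodule.subset_span ⟨Sum.inl ⟨a, ha⟩, rfl⟩)
      · exact Submodule.smul_mem _ _ (Submodule.subset_span ⟨Sum.inr ⟨a, ha⟩, rfl⟩)
    have hPv' : (⇑(frameProj J u S) ∘ v) = Pv := rfl
    rw [hPv']
    conv_rhs => rw [hvz]
    have key : (w (m + 1)) (Pv + z) = ∑ s : Finset (Fin (m + 1)), (w (m + 1)) (s.piecewise Pv z) :=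
      (w (m + 1)).toContinuousMultilinearMap.map_add_univ Pv z
    rw [key, ← Finset.sum_erase_add _ _ (mem_univ Finset.univ), Finset.piecewise_univ,
      Finset.sum_eq_zero, zero_add]
    intro s hs
    obtain ⟨i, hi⟩ : ∃ i, i ∉ s := by
      by_contra hall
      push Not at hall
      exact (Finset.mem_erase.1 hs).1 (Finset.eq_univ_iff_forall.2 hall)
    refine apply_eq_zero_of_curryLeft_eq_zero (w (m + 1)) Z hZker _ (i := i) ?_
    rw [Finset.piecewise_eq_of_notMem _ _ _ hi]
    exact hzZ i

include hJJ hJ hu huJ in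
/-- Conversely, invariance under `frameProj S` forces support in `S`: `uₐ ⌟ P^* w = P^*(P uₐ ⌟ w)`
and `P uₐ = 0` for `a ∉ S`. [folklore] -/
theorem isFrameSupported_of_pullG_frameProj {S : Finset (Fin d)} {w : GForm V F}
    (h : pullG (frameProj J u S) w = w) : IsFrameSupported J u S w := by
  have h0 : GForm.curryLeftG (0 : V) w = 0 := by
    funext m; rw [curryLeftG_apply]; exact (w (m + 1)).curryLeft.map_zero
  intro a ha
  constructor
  · rw [← h, curryLeftG_pullG, frameProj_u J hJJ hJ u hu huJ, if_neg ha, h0, LinearMap.map_zero]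
  · rw [← h, curryLeftG_pullG, frameProj_Ju J hJ u hu huJ, if_neg ha, h0, LinearMap.map_zero]

include hJJ hJ hu huJ in
/-- **Support in `S` ⟺ invariance under pull-back by `frameProj S`.** [folklore] -/
theorem isFrameSupported_iff_pullG [FiniteDimensional ℝ V] (hd : finrank ℝ V = 2 * d)
    {S : Finset (Fin d)} {w : GForm V F} :
    IsFrameSupported J u S w ↔ pullG (frameProj J u S) w = w :=
  ⟨fun h ↦ h.pullG_frameProj J hJJ hJ u hu huJ hd, isFrameSupported_of_pullG_frameProj J hJJ hJ u hu huJ⟩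

include hJJ hJ hu huJ in
/-- **Supports are stable under the shuffle wedge.** [folklore] -/
theorem IsFrameSupported.wedgeG [FiniteDimensional ℝ V] (hd : finrank ℝ V = 2 * d)
    {A : Type*} [NormedCommRing A] [NormedAlgebra ℝ A]
    {S : Finset (Fin d)} {w w' : GForm V A} (h : IsFrameSupported J u S w)
    (h' : IsFrameSupported J u S w') : IsFrameSupported J u S (wedgeG w w') := by
  rw [isFrameSupported_iff_pullG J hJJ hJ u hu huJ hd] at h h' ⊢
  rw [pullG_wedgeG, h, h']

include hJJ hJ hu huJ in
/-- **Vanishing above the top degree**: a graded form supported in `S` has no components of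
degree `> 2|S|` (more than `2|S|` projected arguments are linearly dependent). [folklore] -/
theorem IsFrameSupported.apply_eq_zero_of_lt [FiniteDimensional ℝ V] (hd : finrank ℝ V = 2 * d)
    {S : Finset (Fin d)} {w : GForm V F}
    (h : IsFrameSupported J u S w) {m : ℕ} (hm : 2 * S.card < m) : w m = 0 := by
  rw [← h.pullG_frameProj J hJJ hJ u hu huJ hd, pullG_apply]
  ext v
  rw [compContinuousLinearMap_apply]
  have := (w m).toAlternatingMap.map_linearDependent (fun i ↦ frameProj J u S (v i))
    (not_linearIndependent_frameProj J u S hm v)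
  rw [ContinuousAlternatingMap.coe_toAlternatingMap] at this
  exact this

include hJJ hJ hu huJ in
/-- **A homogeneous graded form supported in `S` and of degree `> 2|S|` is zero.** [folklore] -/
theorem IsFrameSupported.eq_zero_of_isHomog [FiniteDimensional ℝ V] (hd : finrank ℝ V = 2 * d)
    {S : Finset (Fin d)} {w : GForm V F}
    (h : IsFrameSupported J u S w) {m : ℕ} (hh : IsHomog m w) (hm : 2 * S.card < m) : w = 0 :=
  hh.eq_zero_iff.2 (h.apply_eq_zero_of_lt J hJJ hJ u hu huJ hd hm)

/-! ### Rotations and weights -/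

/-- **The rotation `R_t = cos t + sin t · J`** of the real vector space with complex structure `J`
(`e^{it}` on `(V, J)`; the tree's `tangentRotate`, `tangentRotate_eq_cos_add_sin_tangentJ`).
[cite: Voisin2002, §2.3.1] -/
def frameRot (t : ℝ) : V →L[ℝ] V := Real.cos t • ContinuousLinearMap.id ℝ V + Real.sin t • J

/-- Unfolding of `frameRot`. [folklore] -/
@[simp]
theorem frameRot_apply (t : ℝ) (v : V) : frameRot J t v = Real.cos t • v + Real.sin t • J v := rfl

/-- A `ℂ`-valued graded form has **weight `n`** if `R_t^* w = e^{int} w` for every `t` (for a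
complex `k`-form: type `(p, q)` with `p - q = n`, Voisin (2002), §2.3.1). [cite: Voisin2002, §2.3.1] -/
def HasRotWeight (n : ℤ) (w : GForm V ℂ) : Prop :=
  ∀ t : ℝ, pullG (frameRot J t) w = Complex.exp (n * t * Complex.I) • w

namespace HasRotWeight

variable {J} {n : ℤ} {w w' : GForm V ℂ}

/-- `0` has every weight. [folklore] -/
theorem zero (n : ℤ) : HasRotWeight J n (0 : GForm V ℂ) := fun t ↦ by rw [LinearMap.map_zero, smul_zero]

/-- Weights are stable under addition. [folklore] -/
theorem add (h : HasRotWeight J n w) (h' : HasRotWeight J n w') : HasRotWeight J n (w + w') := fun t ↦ by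
  rw [map_add, h t, h' t, smul_add]

/-- Weights are stable under complex scalars. [folklore] -/
theorem smul (h : HasRotWeight J n w) (c : ℂ) : HasRotWeight J n (c • w) := fun t ↦ by
  rw [pullG_smul_complex, h t, smul_comm]

/-- Weights are stable under real scalars. [folklore] -/
theorem smul_real (h : HasRotWeight J n w) (c : ℝ) : HasRotWeight J n (c • w) := fun t ↦ by
  rw [map_smul, h t, smul_comm]

/-- Weights are stable under negation. [folklore] -/
theorem neg (h : HasRotWeight J n w) : HasRotWeight J n (-w) := fun t ↦ by rw [map_neg, h t, smul_neg]

/-- Weights are stable under subtraction. [folklore] -/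
theorem sub (h : HasRotWeight J n w) (h' : HasRotWeight J n w') : HasRotWeight J n (w - w') := by
  rw [sub_eq_add_neg]; exact h.add h'.neg

/-- Weights are stable under finite sums. [folklore] -/
theorem sum {ι : Type*} (s : Finset ι) {w : ι → GForm V ℂ} (h : ∀ i ∈ s, HasRotWeight J n (w i)) :
    HasRotWeight J n (∑ i ∈ s, w i) := by
  classical
  induction s using Finset.induction_on with
  | empty => rw [sum_empty]; exact zero n
  | insert a s ha ih =>
    rw [sum_insert ha]
    exact (h a (mem_insert_self a s)).add (ih fun i hi ↦ h i (mem_insert_of_mem hi))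

/-- Conjugation negates the weight. [folklore] -/
theorem conjG (h : HasRotWeight J n w) : HasRotWeight J (-n) (GForm.conjG w) := fun t ↦ by
  rw [← conjG_pullG, h t, conjG_smul, ← Complex.exp_conj]
  congr 2
  simp only [map_mul, Complex.conj_ofReal, Complex.conj_I, mul_neg, Int.cast_neg, neg_mul]
  rw [map_intCast]

/-- A non-zero homogeneous graded form of degree `0` has weight `0` only: rotations act trivially
in degree `0`. [folklore] -/
theorem eq_zero_of_isHomog_zero (h : HasRotWeight J n w) (h0 : IsHomog 0 w) (hn : n ≠ 0) : w = 0 := by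
  -- at `t = π / n` the character is `e^{iπ} = -1`, while `R_t^* w = w` in degree `0`
  have ht := h (Real.pi / n)
  have hpull : pullG (frameRot J (Real.pi / n)) w = w := by
    rw [h0.eq_of, pullG_of]
    congr 1
    ext v
    simp [Subsingleton.elim (⇑(frameRot J (Real.pi / ↑n)) ∘ v) v]
  have hexp : Complex.exp (n * (Real.pi / n : ℝ) * Complex.I) = -1 := by
    have : (n : ℂ) * (Real.pi / n : ℝ) = Real.pi := by
      push_cast
      field_simp
    rw [this, Complex.exp_pi_mul_I]
  rw [hpull, hexp, neg_one_smul, eq_neg_iff_add_eq_zero, ← two_smul ℂ] at ht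
  exact (smul_eq_zero.1 ht).resolve_left two_ne_zero

end HasRotWeight

include hJJ in
/-- `R_t` commutes with `J`. [folklore] -/
theorem frameRot_J (t : ℝ) (v : V) : frameRot J t (J v) = J (frameRot J t v) := by
  rw [frameRot_apply, frameRot_apply, map_add, map_smul, map_smul, hJJ]

include hJJ hJ in
/-- **The coframe under rotation**: `θ_x ∘ R_t = cos t · θ_x - sin t · θ_{Jx}` for `θ_x = ⟪x, ·⟫`.
[cite: Voisin2002, §2.3.1] -/
theorem innerSL_comp_frameRot (t : ℝ) (x : V) :
    (innerSL ℝ x).comp (frameRot J t) = Real.cos t • innerSL ℝ x - Real.sin t • innerSL ℝ (J x) := by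
  ext v
  simp only [ContinuousLinearMap.comp_apply, innerSL_apply_apply, frameRot_apply,
    _root_.sub_apply, _root_.smul_apply, inner_add_right, inner_smul_right, smul_eq_mul]
  rw [inner_J_left_eq_neg J hJJ hJ x v, show ⟪x, J v⟫_ℝ = -⟪J x, v⟫_ℝ by
    rw [inner_J_left_eq_neg J hJJ hJ, neg_neg]]
  ring

include hJJ hJ in
/-- `θ_{Jx} ∘ R_t = sin t · θ_x + cos t · θ_{Jx}`. [cite: Voisin2002, §2.3.1] -/
theorem innerSL_J_comp_frameRot (t : ℝ) (x : V) :
    (innerSL ℝ (J x)).comp (frameRot J t) = Real.sin t • innerSL ℝ x + Real.cos t • innerSL ℝ (J x) := by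
  have h := innerSL_comp_frameRot J hJJ hJ t (J x)
  rw [hJJ, map_neg, smul_neg, sub_neg_eq_add, add_comm] at h
  exact h

/-- `e^{i(n+1)t} = e^{int} (cos t + i sin t)`. [folklore] -/
theorem exp_int_succ_mul (n : ℤ) (t : ℝ) :
    Complex.exp (((n + 1 : ℤ) : ℂ) * t * Complex.I) =
      Complex.exp (n * t * Complex.I) * (Real.cos t + Real.sin t * Complex.I) := by
  have : (Real.cos t : ℂ) + Real.sin t * Complex.I = Complex.exp (t * Complex.I) := by
    rw [Complex.exp_mul_I, ← Complex.ofReal_cos, ← Complex.ofReal_sin]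
  rw [this, ← Complex.exp_add]
  congr 1; push_cast; ring

/-- `e^{i(n-1)t} = e^{int} (cos t - i sin t)`. [folklore] -/
theorem exp_int_pred_mul (n : ℤ) (t : ℝ) :
    Complex.exp (((n - 1 : ℤ) : ℂ) * t * Complex.I) =
      Complex.exp (n * t * Complex.I) * (Real.cos t - Real.sin t * Complex.I) := by
  have : (Real.cos t : ℂ) - Real.sin t * Complex.I = Complex.exp (-t * Complex.I) := by
    rw [Complex.exp_mul_I, Complex.cos_neg, Complex.sin_neg, ← Complex.ofReal_cos, ← Complex.ofReal_sin]
    ring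
  rw [this, ← Complex.exp_add]
  congr 1; push_cast; ring

/-- `i • i • w = -w`. [folklore] -/
theorem I_smul_I_smul (w : GForm V ℂ) : Complex.I • Complex.I • w = -w := by
  rw [smul_smul, Complex.I_mul_I, neg_one_smul]

/-! ### Weights of wedges and interior products against the frame -/

namespace HasRotWeight

variable {J} {n : ℤ} {w : GForm V ℂ}

/-- **The `(1,0)`-covector `ζ_x = θ_x + i θ_{Jx}` raises the weight by one**:
if `w` has weight `n` then `θ_x ∧ w + i · θ_{Jx} ∧ w` has weight `n + 1`. [cite: Voisin2002, §2.3.1] -/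
theorem zeta_wedge (hJJ : ∀ v, J (J v) = -v) (hJ : ∀ v w, ⟪J v, J w⟫_ℝ = ⟪v, w⟫_ℝ)
    (h : HasRotWeight J n w) (x : V) :
    HasRotWeight J (n + 1) (wedgeOneG (innerSL ℝ x) w + Complex.I • wedgeOneG (innerSL ℝ (J x)) w) := by
  intro t
  rw [map_add, pullG_smul_complex, pullG_wedgeOneG, pullG_wedgeOneG, innerSL_comp_frameRot J hJJ hJ,
    innerSL_J_comp_frameRot J hJJ hJ, h t, wedgeOneG_sub_left, wedgeOneG_add_left, wedgeOneG_smul_left,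
    wedgeOneG_smul_left, wedgeOneG_smul_left, wedgeOneG_smul_left, wedgeOneG_smul_complex,
    wedgeOneG_smul_complex, exp_int_succ_mul]
  set A := wedgeOneG (innerSL ℝ x) w
  set B := wedgeOneG (innerSL ℝ (J x)) w
  set E := Complex.exp (n * t * Complex.I)
  rw [← coe_real_smul (Real.cos t), ← coe_real_smul (Real.sin t), ← coe_real_smul (Real.cos t),
    ← coe_real_smul (Real.sin t)]
  have hI : Complex.I • Complex.I • (E • B) = -(E • B) := I_smul_I_smul _
  -- expand the right-hand side and compare
  have erhs : (E * (Real.cos t + Real.sin t * Complex.I)) • (A + Complex.I • B) =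
      (Real.cos t : ℂ) • E • A + (Real.sin t : ℂ) • Complex.I • (E • A) +
        ((Real.cos t : ℂ) • Complex.I • (E • B) + (Real.sin t : ℂ) • Complex.I • Complex.I • (E • B)) := by
    module
  rw [erhs, hI]
  module

/-- **The `(0,1)`-covector `ζ̄_x = θ_x - i θ_{Jx}` lowers the weight by one.** [cite: Voisin2002, §2.3.1] -/
theorem zetaBar_wedge (hJJ : ∀ v, J (J v) = -v) (hJ : ∀ v w, ⟪J v, J w⟫_ℝ = ⟪v, w⟫_ℝ)
    (h : HasRotWeight J n w) (x : V) :
    HasRotWeight J (n - 1) (wedgeOneG (innerSL ℝ x) w - Complex.I • wedgeOneG (innerSL ℝ (J x)) w) := by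
  intro t
  rw [map_sub, pullG_smul_complex, pullG_wedgeOneG, pullG_wedgeOneG, innerSL_comp_frameRot J hJJ hJ,
    innerSL_J_comp_frameRot J hJJ hJ, h t, wedgeOneG_sub_left, wedgeOneG_add_left, wedgeOneG_smul_left,
    wedgeOneG_smul_left, wedgeOneG_smul_left, wedgeOneG_smul_left, wedgeOneG_smul_complex,
    wedgeOneG_smul_complex, exp_int_pred_mul]
  set A := wedgeOneG (innerSL ℝ x) w
  set B := wedgeOneG (innerSL ℝ (J x)) w
  set E := Complex.exp (n * t * Complex.I)
  rw [← coe_real_smul (Real.cos t), ← coe_real_smul (Real.sin t), ← coe_real_smul (Real.cos t),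
    ← coe_real_smul (Real.sin t)]
  have hI : Complex.I • Complex.I • (E • B) = -(E • B) := I_smul_I_smul _
  have erhs : (E * (Real.cos t - Real.sin t * Complex.I)) • (A - Complex.I • B) =
      (Real.cos t : ℂ) • E • A - (Real.sin t : ℂ) • Complex.I • (E • A) -
        ((Real.cos t : ℂ) • Complex.I • (E • B) - (Real.sin t : ℂ) • Complex.I • Complex.I • (E • B)) := by
    module
  rw [erhs, hI]
  module

/-- The pull-backs of the two contractions of a weight vector along the rotation (the rotation
system): `R_t^*(x ⌟ w) = e^{int}(cos t · x ⌟ w - sin t · Jx ⌟ w)`. [folklore] -/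
theorem pullG_curryLeftG (hJJ : ∀ v, J (J v) = -v) (h : HasRotWeight J n w) (x : V) (t : ℝ) :
    pullG (frameRot J t) (curryLeftG x w) =
      Complex.exp (n * t * Complex.I) • (Real.cos t • curryLeftG x w - Real.sin t • curryLeftG (J x) w) := by
  have hx := curryLeftG_pullG (frameRot J t) x w
  have hy := curryLeftG_pullG (frameRot J t) (J x) w
  rw [h t, curryLeftG_smul_complex, frameRot_apply, curryLeftG_add_left, curryLeftG_smul_left,
    curryLeftG_smul_left, map_add, map_smul, map_smul] at hx
  rw [h t, curryLeftG_smul_complex, frameRot_apply, hJJ, smul_neg, ← sub_eq_add_neg, curryLeftG_sub_left,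
    curryLeftG_smul_left, curryLeftG_smul_left, map_sub, map_smul, map_smul] at hy
  set E := Complex.exp (n * t * Complex.I)
  set P := pullG (frameRot J t) (curryLeftG x w)
  set Q := pullG (frameRot J t) (curryLeftG (J x) w)
  -- `hx : E • x ⌟ w = cos P + sin Q`, `hy : E • Jx ⌟ w = cos Q - sin P`
  rw [smul_sub, smul_comm E (Real.cos t), smul_comm E (Real.sin t), hx, hy]
  have hc := Real.cos_sq_add_sin_sq t
  have e : P = (Real.cos t ^ 2 + Real.sin t ^ 2) • P := by rw [hc, one_smul]
  conv_lhs => rw [e]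
  module

/-- The second half of the rotation system:
`R_t^*(Jx ⌟ w) = e^{int}(sin t · x ⌟ w + cos t · Jx ⌟ w)`. [folklore] -/
theorem pullG_curryLeftG_J (hJJ : ∀ v, J (J v) = -v) (h : HasRotWeight J n w) (x : V) (t : ℝ) :
    pullG (frameRot J t) (curryLeftG (J x) w) =
      Complex.exp (n * t * Complex.I) • (Real.sin t • curryLeftG x w + Real.cos t • curryLeftG (J x) w) := by
  have hx := curryLeftG_pullG (frameRot J t) x w
  have hy := curryLeftG_pullG (frameRot J t) (J x) w
  rw [h t, curryLeftG_smul_complex, frameRot_apply, curryLeftG_add_left, curryLeftG_smul_left,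
    curryLeftG_smul_left, map_add, map_smul, map_smul] at hx
  rw [h t, curryLeftG_smul_complex, frameRot_apply, hJJ, smul_neg, ← sub_eq_add_neg, curryLeftG_sub_left,
    curryLeftG_smul_left, curryLeftG_smul_left, map_sub, map_smul, map_smul] at hy
  set E := Complex.exp (n * t * Complex.I)
  set P := pullG (frameRot J t) (curryLeftG x w)
  set Q := pullG (frameRot J t) (curryLeftG (J x) w)
  rw [smul_add, smul_comm E (Real.cos t), smul_comm E (Real.sin t), hx, hy]
  have hc := Real.cos_sq_add_sin_sq t
  have e : Q = (Real.cos t ^ 2 + Real.sin t ^ 2) • Q := by rw [hc, one_smul]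
  conv_lhs => rw [e]
  module

/-- **Interior products against the frame vectors**: if `w` has weight `n` then
`x ⌟ w - i (Jx) ⌟ w` (twice the contraction with `∂/∂z_x`) has weight `n - 1`.
[cite: Voisin2002, §2.3.1] -/
theorem curryLeftG_zeta (hJJ : ∀ v, J (J v) = -v) (h : HasRotWeight J n w) (x : V) :
    HasRotWeight J (n - 1) (curryLeftG x w - Complex.I • curryLeftG (J x) w) := by
  intro t
  rw [map_sub, pullG_smul_complex, h.pullG_curryLeftG hJJ x t, h.pullG_curryLeftG_J hJJ x t, exp_int_pred_mul]
  set E := Complex.exp (n * t * Complex.I)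
  set A := curryLeftG x w
  set B := curryLeftG (J x) w
  rw [← coe_real_smul (Real.cos t), ← coe_real_smul (Real.sin t), ← coe_real_smul (Real.cos t),
    ← coe_real_smul (Real.sin t)]
  have hI : Complex.I • Complex.I • (E • B) = -(E • B) := I_smul_I_smul _
  have erhs : (E * (Real.cos t - Real.sin t * Complex.I)) • (A - Complex.I • B) =
      (Real.cos t : ℂ) • E • A - (Real.sin t : ℂ) • Complex.I • (E • A) -
        ((Real.cos t : ℂ) • Complex.I • (E • B) - (Real.sin t : ℂ) • Complex.I • Complex.I • (E • B)) := by
    module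
  rw [erhs, hI]
  module

/-- **The double contraction `Jx ⌟ x ⌟ w` preserves the weight.** [cite: Voisin2002, §2.3.1] -/
theorem curryLeftG_curryLeftG (hJJ : ∀ v, J (J v) = -v) (h : HasRotWeight J n w) (x : V) :
    HasRotWeight J n (curryLeftG (J x) (curryLeftG x w)) := by
  intro t
  set E := Complex.exp (n * t * Complex.I) with hE
  -- `R^*(x ⌟ w) = E (cos x⌟w - sin Jx⌟w)`; contract once more with `Jx` and with `x`
  have hP := h.pullG_curryLeftG hJJ x t
  have hy2 := curryLeftG_pullG (frameRot J t) (J x) (curryLeftG x w)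
  have hx2 := curryLeftG_pullG (frameRot J t) x (curryLeftG x w)
  rw [hP, frameRot_apply, hJJ, smul_neg, ← sub_eq_add_neg, curryLeftG_sub_left, curryLeftG_smul_left,
    curryLeftG_smul_left, curryLeftG_curryLeftG_self, smul_zero, sub_zero, curryLeftG_smul_complex, map_sub,
    map_smul, map_smul, curryLeftG_curryLeftG_self, smul_zero, sub_zero, map_smul] at hy2
  rw [hP, frameRot_apply, curryLeftG_add_left, curryLeftG_smul_left, curryLeftG_smul_left,
    curryLeftG_curryLeftG_self, smul_zero, zero_add, curryLeftG_smul_complex, map_sub, map_smul, map_smul,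
    map_smul, curryLeftG_curryLeftG_self, smul_zero, zero_sub, GForm.curryLeftG_curryLeftG, smul_neg,
    smul_neg, smul_neg, neg_neg] at hx2
  -- `hy2 : E • cos • D = cos • T`, `hx2 : E • sin • D = sin • T` for `D = Jx ⌟ x ⌟ w`, `T = R^* D`
  set T := pullG (frameRot J t) (curryLeftG (J x) (curryLeftG x w)) with hT
  set D := curryLeftG (J x) (curryLeftG x w)
  have hc := Real.cos_sq_add_sin_sq t
  calc T = (Real.cos t ^ 2 + Real.sin t ^ 2) • T := by rw [hc, one_smul]
    _ = Real.cos t • (Real.cos t • T) + Real.sin t • (Real.sin t • T) := by module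
    _ = Real.cos t • (E • (Real.cos t • D)) + Real.sin t • (E • (Real.sin t • D)) := by rw [hy2, hx2]
    _ = E • D := by
      rw [smul_comm (Real.cos t) E, smul_comm (Real.sin t) E, ← smul_add, smul_smul, smul_smul,
        ← add_smul, ← sq, ← sq, hc, one_smul]

end HasRotWeight

end Frame

end Literature.Geometry.Kaehler

end
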